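import Mathlib.Analysis.Calculus.ContDiff.Bounds
import Mathlib.Analysis.CStarAlgebra.Matrix
import Literature.Analysis.FluidPDE.OnsagerBDSVMikadoBounds
import Literature.Analysis.FluidPDE.OnsagerBDSVBiotSavart
import HarnessLib

/-!
# The BDSV perturbation: pointwise Leibniz bounds for the lifted potential (Prop. 5.7, Cor. 5.8)

Buckmaster–De Lellis–Székelyhidi–Vicol (BDSV), *Onsager's conjecture for admissible weak
solutions*, CPAM 72 (2019) = arXiv:1701.08678, §5.5. The proof of Cor. 5.8 differentiates the
perturbation `w_{q+1} = n⁻¹ curl Z` once and twice ("Compute now `∇w_{o,i} = …`", (5.34)–(5.35)),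
the principal term carrying one factor `λ_{q+1}` per derivative (from `e^{iλ_{q+1}k·Φᵢ}`, (5.34):
`‖∇(e^{iλk·Φ})‖₀ ≤ 2λ|k|`) and all other factors being controlled by Prop. 5.7
(`‖∇Φᵢ‖_N + ‖R̃_{q,i}‖_N ≲ ℓ^{-N}`, `‖b_{i,k}‖_N ≲ δ^{1/2}|k|^{-6}ℓ^{-N}`). For the curl-form
potential of `OnsagerBDSVPerturbation.lean`, whose `i`-th summand lifts to
`BDSV.liftSummand V σ c n η R̊̄ D (y) = (σ η) • ∇Φᵀ V(R̃, n(y + D))` (`OnsagerBDSVMikadoBounds.lean`),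
this file PROVES the corresponding pointwise bounds by the Leibniz and Faà di Bruno estimates of
Mathlib (`norm_iteratedFDeriv_comp_le`, `norm_iteratedFDeriv_mul_le`, `norm_iteratedFDeriv_clm_apply`,
`norm_iteratedFDeriv_smul_le`).

Matrices enter only through their action: all matrix-valued functions are carried by the normed
ring `𝕃 = ℝ³ →L ℝ³` of continuous linear maps (genuine operator norms), through Mathlib's
⋆-algebra equivalence `Matrix.toEuclideanCLM : 𝕄 ≃⋆ₐ 𝕃`; `BDSV.summandCL` is the summand in this
carrier and `BDSV.liftSummand_eq_summandCL` the bridge to the matrix form.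

* `BDSV.gradPhiCL = Id + D(lift D)`, `BDSV.transposeCL`, `BDSV.ofColsCL`, `BDSV.stressCL`
  (`R̃ = ∇Φ (Id - cR̊̄) ∇Φᵀ` as a product in `𝕃`), `BDSV.mikadoLiftCL V (S, ξ) = V(mat S, proj ξ)`
  with its periodicity and uniform derivative bounds on `K × ℝ³`, `K ⊆ 𝕃` compact
  (`BDSV.exists_forall_le_norm_iteratedFDeriv_mikadoLiftCL_le` — the role of (5.7) / Remark 5.2 /
  Lemma 5.5), `BDSV.summandCL`, and the bridge identities;
* first- and second-order Leibniz bounds (`BDSV.norm_iteratedFDeriv_smul_one_le`, `…`);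
* **the summand bound** `BDSV.norm_iteratedFDeriv_summandCL_le`: if at the point `y`
  `|η| ≤ 1`, `‖Dη‖ ≤ n`, `‖D²η‖ ≤ n²`, `‖D(lift D)‖ ≤ 1`, `‖D²(lift D)‖ ≤ n`, `‖D³(lift D)‖ ≤ n²`,
  `‖DR̃‖ ≤ n`, `‖D²R̃‖ ≤ n²`, `R̃(y) ∈ K` and `‖Dᵐ V‖ ≤ C_V` on `K × ℝ³` for `m ≤ 2`, then
  `‖D¹(summand)(y)‖ ≤ K_Z C_V σ n` and `‖D²(summand)(y)‖ ≤ K_Z C_V σ n²` with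
  `K_Z = BDSV.summandConst = 33 ‖transposeCL‖` (the normalised form of (5.33)–(5.35): one power of
  the frequency per derivative, times `ρ_{q,i}^{1/2} ∼ σ`);
* **the stress-argument bounds** for `R̃` from bounds on `D`, `R̊̄` (`BDSV.norm_stressCL_sub_one_le`,
  `BDSV.norm_iteratedFDeriv_stressCL_le`: the content of (5.32)–(5.33) and of
  `|R̃_{q,i} - Id| ≲ ℓ^α` in Lemma 5.4);
* **curl through the lift** (`BDSV.curlCLM`, `BDSV.curl_proj_eq`, `BDSV.norm_curl_proj_le`,
  `BDSV.norm_partialDeriv_curl_proj_le`; smoothness of the curl is the tree's `BDSV.isSmooth_curl`): `‖curl Z‖ ≤ ‖curlCLM‖ ‖D(lift Z)‖`,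
  `‖∂ᵢ curl Z‖ ≤ ‖curlCLM‖ ‖D²(lift Z)‖`.

## References

* T. Buckmaster, C. De Lellis, L. Székelyhidi Jr., V. Vicol, *Onsager's conjecture for admissible
  weak solutions*, Comm. Pure Appl. Math. 72 (2019) 229–274 = arXiv:1701.08678, §5.5:
  Prop. 5.7 (5.29)–(5.30), (5.32)–(5.33); Cor. 5.8 (5.31), (5.33)–(5.37); Lemma 5.4; §5.1 (5.7),
  Remark 5.2.
-/

open MeasureTheory Set
open scoped NNReal ENNReal ContDiff Matrix Matrix.Norms.Elementwise

noncomputable section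

namespace Literature.Analysis.FluidPDE

namespace BDSV

open FunctionSpaces FunctionSpaces.Torus

/-- The flat three-torus `T³ = (ℝ/ℤ)³`, local notation. -/
local notation "𝕋³" => UnitAddTorus (Fin 3)

/-- Euclidean `ℝ³`, local notation. -/
local notation "ℝ³" => EuclideanSpace ℝ (Fin 3)

/-- Real `3 × 3` matrices, local notation. -/
local notation "𝕄" => Matrix (Fin 3) (Fin 3) ℝ

/-- Continuous linear endomorphisms of `ℝ³` (the carrier of all matrix-valued functions of this
file), local notation. -/
local notation "𝕃" => (EuclideanSpace ℝ (Fin 3) →L[ℝ] EuclideanSpace ℝ (Fin 3))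

/-! ## First- and second-order Leibniz bounds -/

section Leibniz

variable {E F₁ F₂ F₃ : Type*} [NormedAddCommGroup E] [NormedSpace ℝ E]
  [NormedAddCommGroup F₁] [NormedSpace ℝ F₁] [NormedAddCommGroup F₂] [NormedSpace ℝ F₂]
  [NormedAddCommGroup F₃] [NormedSpace ℝ F₃]

/-- `‖D¹f(x)‖ = ‖Df(x)‖`. [folklore] -/
theorem norm_iteratedFDeriv_one_eq_norm_fderiv (f : E → F₁) (x : E) :
    ‖iteratedFDeriv ℝ 1 f x‖ = ‖fderiv ℝ f x‖ := by
  rw [← norm_iteratedFDeriv_fderiv, norm_iteratedFDeriv_zero]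

/-- `‖D²f(x)‖ = ‖D(Df)(x)‖`. [folklore] -/
theorem norm_iteratedFDeriv_two_eq_norm_fderiv_fderiv (f : E → F₁) (x : E) :
    ‖iteratedFDeriv ℝ 2 f x‖ = ‖fderiv ℝ (fderiv ℝ f) x‖ := by
  rw [← norm_iteratedFDeriv_fderiv, norm_iteratedFDeriv_one_eq_norm_fderiv]

/-- First-order Leibniz bound for products in a normed algebra:
`‖D(fg)‖ ≤ ‖f‖ ‖Dg‖ + ‖Df‖ ‖g‖`. [folklore] -/
theorem norm_iteratedFDeriv_mul_one_le {A : Type*} [NormedRing A] [NormedAlgebra ℝ A] {f g : E → A}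
    (hf : ContDiff ℝ ∞ f) (hg : ContDiff ℝ ∞ g) (x : E) :
    ‖iteratedFDeriv ℝ 1 (fun y => f y * g y) x‖ ≤
      ‖f x‖ * ‖iteratedFDeriv ℝ 1 g x‖ + ‖iteratedFDeriv ℝ 1 f x‖ * ‖g x‖ := by
  have key := norm_iteratedFDeriv_mul_le hf hg x (n := 1) (WithTop.coe_le_coe.2 le_top)
  refine key.trans (le_of_eq ?_)
  simp only [Finset.sum_range_succ, Finset.sum_range_zero, zero_add, Nat.choose_zero_right,
    Nat.choose_self, Nat.cast_one, one_mul, Nat.sub_zero, Nat.reduceSub, norm_iteratedFDeriv_zero]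

/-- Second-order Leibniz bound for products in a normed algebra:
`‖D²(fg)‖ ≤ ‖f‖ ‖D²g‖ + 2‖Df‖ ‖Dg‖ + ‖D²f‖ ‖g‖`. [folklore] -/
theorem norm_iteratedFDeriv_mul_two_le {A : Type*} [NormedRing A] [NormedAlgebra ℝ A] {f g : E → A}
    (hf : ContDiff ℝ ∞ f) (hg : ContDiff ℝ ∞ g) (x : E) :
    ‖iteratedFDeriv ℝ 2 (fun y => f y * g y) x‖ ≤
      ‖f x‖ * ‖iteratedFDeriv ℝ 2 g x‖ +
        2 * ‖iteratedFDeriv ℝ 1 f x‖ * ‖iteratedFDeriv ℝ 1 g x‖ + ‖iteratedFDeriv ℝ 2 f x‖ * ‖g x‖ := by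
  have key := norm_iteratedFDeriv_mul_le hf hg x (n := 2) (WithTop.coe_le_coe.2 le_top)
  refine key.trans (le_of_eq ?_)
  simp only [Finset.sum_range_succ, Finset.sum_range_zero, zero_add, Nat.choose_zero_right,
    Nat.choose_self, Nat.cast_one, one_mul, Nat.sub_zero, Nat.reduceSub, norm_iteratedFDeriv_zero,
    show Nat.choose 2 1 = 2 from rfl, Nat.cast_ofNat]

/-- First-order Leibniz bound for the evaluation of a linear-map field:
`‖D(F u)‖ ≤ ‖F‖ ‖Du‖ + ‖DF‖ ‖u‖`. [folklore] -/
theorem norm_iteratedFDeriv_clm_apply_one_le {f : E → F₁ →L[ℝ] F₂} {g : E → F₁}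
    (hf : ContDiff ℝ ∞ f) (hg : ContDiff ℝ ∞ g) (x : E) :
    ‖iteratedFDeriv ℝ 1 (fun y => (f y) (g y)) x‖ ≤
      ‖f x‖ * ‖iteratedFDeriv ℝ 1 g x‖ + ‖iteratedFDeriv ℝ 1 f x‖ * ‖g x‖ := by
  have key := norm_iteratedFDeriv_clm_apply hf hg x (n := 1) (WithTop.coe_le_coe.2 le_top)
  refine key.trans (le_of_eq ?_)
  simp only [Finset.sum_range_succ, Finset.sum_range_zero, zero_add, Nat.choose_zero_right,
    Nat.choose_self, Nat.cast_one, one_mul, Nat.sub_zero, Nat.reduceSub, norm_iteratedFDeriv_zero]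

/-- Second-order Leibniz bound for the evaluation of a linear-map field:
`‖D²(F u)‖ ≤ ‖F‖ ‖D²u‖ + 2‖DF‖ ‖Du‖ + ‖D²F‖ ‖u‖`. [folklore] -/
theorem norm_iteratedFDeriv_clm_apply_two_le {f : E → F₁ →L[ℝ] F₂} {g : E → F₁}
    (hf : ContDiff ℝ ∞ f) (hg : ContDiff ℝ ∞ g) (x : E) :
    ‖iteratedFDeriv ℝ 2 (fun y => (f y) (g y)) x‖ ≤
      ‖f x‖ * ‖iteratedFDeriv ℝ 2 g x‖ +
        2 * ‖iteratedFDeriv ℝ 1 f x‖ * ‖iteratedFDeriv ℝ 1 g x‖ + ‖iteratedFDeriv ℝ 2 f x‖ * ‖g x‖ := by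
  have key := norm_iteratedFDeriv_clm_apply hf hg x (n := 2) (WithTop.coe_le_coe.2 le_top)
  refine key.trans (le_of_eq ?_)
  simp only [Finset.sum_range_succ, Finset.sum_range_zero, zero_add, Nat.choose_zero_right,
    Nat.choose_self, Nat.cast_one, one_mul, Nat.sub_zero, Nat.reduceSub, norm_iteratedFDeriv_zero,
    show Nat.choose 2 1 = 2 from rfl, Nat.cast_ofNat]

/-- First-order Leibniz bound for scalar multiplication:
`‖D(f • g)‖ ≤ ‖f‖ ‖Dg‖ + ‖Df‖ ‖g‖`. [folklore] -/
theorem norm_iteratedFDeriv_smul_one_le {f : E → ℝ} {g : E → F₁}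
    (hf : ContDiff ℝ ∞ f) (hg : ContDiff ℝ ∞ g) (x : E) :
    ‖iteratedFDeriv ℝ 1 (fun y => f y • g y) x‖ ≤
      ‖f x‖ * ‖iteratedFDeriv ℝ 1 g x‖ + ‖iteratedFDeriv ℝ 1 f x‖ * ‖g x‖ := by
  have key := norm_iteratedFDeriv_smul_le hf hg x (n := 1) (WithTop.coe_le_coe.2 le_top)
  refine key.trans (le_of_eq ?_)
  simp only [Finset.sum_range_succ, Finset.sum_range_zero, zero_add, Nat.choose_zero_right,
    Nat.choose_self, Nat.cast_one, one_mul, Nat.sub_zero, Nat.reduceSub, norm_iteratedFDeriv_zero]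

/-- Second-order Leibniz bound for scalar multiplication:
`‖D²(f • g)‖ ≤ ‖f‖ ‖D²g‖ + 2‖Df‖ ‖Dg‖ + ‖D²f‖ ‖g‖`. [folklore] -/
theorem norm_iteratedFDeriv_smul_two_le {f : E → ℝ} {g : E → F₁}
    (hf : ContDiff ℝ ∞ f) (hg : ContDiff ℝ ∞ g) (x : E) :
    ‖iteratedFDeriv ℝ 2 (fun y => f y • g y) x‖ ≤
      ‖f x‖ * ‖iteratedFDeriv ℝ 2 g x‖ +
        2 * ‖iteratedFDeriv ℝ 1 f x‖ * ‖iteratedFDeriv ℝ 1 g x‖ + ‖iteratedFDeriv ℝ 2 f x‖ * ‖g x‖ := by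
  have key := norm_iteratedFDeriv_smul_le hf hg x (n := 2) (WithTop.coe_le_coe.2 le_top)
  refine key.trans (le_of_eq ?_)
  simp only [Finset.sum_range_succ, Finset.sum_range_zero, zero_add, Nat.choose_zero_right,
    Nat.choose_self, Nat.cast_one, one_mul, Nat.sub_zero, Nat.reduceSub, norm_iteratedFDeriv_zero,
    show Nat.choose 2 1 = 2 from rfl, Nat.cast_ofNat]

/-- Derivatives of a constant multiple: `‖Dᵏ(a f)‖ = |a| ‖Dᵏf‖`. [folklore] -/
theorem norm_iteratedFDeriv_const_mul (a : ℝ) {f : E → ℝ} (hf : ContDiff ℝ ∞ f) (k : ℕ) (x : E) :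
    ‖iteratedFDeriv ℝ k (fun y => a * f y) x‖ = |a| * ‖iteratedFDeriv ℝ k f x‖ := by
  have h : (fun y => a * f y) = fun y => a • f y := rfl
  rw [h, iteratedFDeriv_const_smul_apply' (hf.contDiffAt.of_le (WithTop.coe_le_coe.2 le_top)),
    norm_smul, Real.norm_eq_abs]

/-- Derivatives after a continuous linear map: `‖Dᵏ(L ∘ f)‖ ≤ ‖L‖ ‖Dᵏf‖`. [folklore] -/
theorem norm_iteratedFDeriv_clm_comp_le (L : F₁ →L[ℝ] F₂) {f : E → F₁} (hf : ContDiff ℝ ∞ f)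
    (k : ℕ) (x : E) :
    ‖iteratedFDeriv ℝ k (fun y => L (f y)) x‖ ≤ ‖L‖ * ‖iteratedFDeriv ℝ k f x‖ :=
  L.norm_iteratedFDeriv_comp_left (f := f) hf.contDiffAt (WithTop.coe_le_coe.2 le_top)

/-- Derivatives of order `k ≥ 1` of `const - c • f`: `‖Dᵏ(C - c f)‖ = |c| ‖Dᵏ f‖`. [folklore] -/
theorem norm_iteratedFDeriv_const_sub_smul {f : E → F₁} (hf : ContDiff ℝ ∞ f) (C : F₁) (c : ℝ)
    {k : ℕ} (hk : k ≠ 0) (x : E) :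
    ‖iteratedFDeriv ℝ k (fun y => C - c • f y) x‖ = |c| * ‖iteratedFDeriv ℝ k f x‖ := by
  have e : (fun y => C - c • f y) = (fun _ => C) - fun y => c • f y := rfl
  have hcf : ContDiff ℝ ∞ (fun y => c • f y) := hf.const_smul c
  rw [e, iteratedFDeriv_sub_apply contDiff_const.contDiffAt
    (hcf.contDiffAt.of_le (WithTop.coe_le_coe.2 le_top)),
    iteratedFDeriv_const_of_ne hk, Pi.zero_apply, zero_sub, norm_neg,
    iteratedFDeriv_const_smul_apply' (hf.contDiffAt.of_le (WithTop.coe_le_coe.2 le_top)),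
    norm_smul, Real.norm_eq_abs]

/-- Derivatives of order `k ≥ 1` of `C + f`: `Dᵏ(C + f) = Dᵏf`. [folklore] -/
theorem iteratedFDeriv_const_add' {f : E → F₁} (hf : ContDiff ℝ ∞ f) (C : F₁) {k : ℕ} (hk : k ≠ 0)
    (x : E) : iteratedFDeriv ℝ k (fun y => C + f y) x = iteratedFDeriv ℝ k f x := by
  have e : (fun y => C + f y) = (fun _ => C) + f := rfl
  rw [e, iteratedFDeriv_add_apply contDiff_const.contDiffAt
    (hf.contDiffAt.of_le (WithTop.coe_le_coe.2 le_top)), iteratedFDeriv_const_of_ne hk,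
    Pi.zero_apply, zero_add]

/-- The first derivative of `y ↦ n(y + g(y))` is bounded by `|n| (1 + ‖Dg‖)`. [folklore] -/
theorem norm_iteratedFDeriv_one_phase_le {g : E → E} (hg : ContDiff ℝ ∞ g) (n : ℝ) (x : E) :
    ‖iteratedFDeriv ℝ 1 (fun y => n • (y + g y)) x‖ ≤ |n| * (1 + ‖iteratedFDeriv ℝ 1 g x‖) := by
  have h1 : ContDiff ℝ ∞ (fun y : E => y + g y) := contDiff_id.add hg
  have e1 : (fun y => n • (y + g y)) = fun y => n • (fun y : E => y + g y) y := rfl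
  rw [e1, iteratedFDeriv_const_smul_apply' (h1.contDiffAt.of_le (WithTop.coe_le_coe.2 le_top)),
    norm_smul, Real.norm_eq_abs]
  refine mul_le_mul_of_nonneg_left ?_ (abs_nonneg _)
  have e2 : (fun y : E => y + g y) = (id : E → E) + g := rfl
  rw [e2, iteratedFDeriv_add_apply (contDiff_id.contDiffAt) (hg.contDiffAt.of_le (WithTop.coe_le_coe.2 le_top))]
  refine (norm_add_le _ _).trans (add_le_add ?_ le_rfl)
  rw [norm_iteratedFDeriv_one_eq_norm_fderiv, fderiv_id]
  exact ContinuousLinearMap.norm_id_le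

/-- The second derivative of `y ↦ n(y + g(y))` is bounded by `|n| ‖D²g‖`. [folklore] -/
theorem norm_iteratedFDeriv_two_phase_le {g : E → E} (hg : ContDiff ℝ ∞ g) (n : ℝ) (x : E) :
    ‖iteratedFDeriv ℝ 2 (fun y => n • (y + g y)) x‖ ≤ |n| * ‖iteratedFDeriv ℝ 2 g x‖ := by
  have h1 : ContDiff ℝ ∞ (fun y : E => y + g y) := contDiff_id.add hg
  have e1 : (fun y => n • (y + g y)) = fun y => n • (fun y : E => y + g y) y := rfl
  rw [e1, iteratedFDeriv_const_smul_apply' (h1.contDiffAt.of_le (WithTop.coe_le_coe.2 le_top)),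
    norm_smul, Real.norm_eq_abs]
  refine mul_le_mul_of_nonneg_left ?_ (abs_nonneg _)
  have e2 : (fun y : E => y + g y) = (id : E → E) + g := rfl
  rw [e2, iteratedFDeriv_add_apply (contDiff_id.contDiffAt) (hg.contDiffAt.of_le (WithTop.coe_le_coe.2 le_top))]
  refine (norm_add_le _ _).trans ?_
  have h0 : ‖iteratedFDeriv ℝ 2 (id : E → E) x‖ = 0 := by
    rw [norm_iteratedFDeriv_two_eq_norm_fderiv_fderiv]
    have : fderiv ℝ (id : E → E) = fun _ => ContinuousLinearMap.id ℝ E := funext fun _ => fderiv_id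
    rw [this, fderiv_const_apply, norm_zero]
  rw [h0, zero_add]

end Leibniz

/-! ## The construction in the carrier `𝕃 = ℝ³ →L ℝ³` -/

section Carrier

/-- Matrices as continuous linear endomorphisms of `ℝ³` (Mathlib's ⋆-algebra equivalence
`Matrix.toEuclideanCLM` for the standard orthonormal basis): `matCL A u = A u`. [folklore] -/
abbrev matCL : 𝕄 ≃⋆ₐ[ℝ] 𝕃 := Matrix.toEuclideanCLM (n := Fin 3) (𝕜 := ℝ)

/-- `matCL A u = toEuclideanLin A u`. [folklore] -/
theorem matCL_apply (A : 𝕄) (u : ℝ³) : matCL A u = Matrix.toEuclideanLin A u := rfl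

/-- Entries of the matrix of an endomorphism: `(matCL⁻¹ S)_{ab} = (S e_b)_a`, i.e.
`matCL.symm = BDSV.jacCLM`. [folklore] -/
theorem matCL_symm_apply (S : 𝕃) (a b : Fin 3) : matCL.symm S a b = S (EuclideanSpace.single b 1) a := by
  set A := matCL.symm S with hA
  have hS : S = matCL A := (matCL.apply_symm_apply S).symm
  rw [hS]
  simp [EuclideanSpace.single, -StarAlgEquiv.apply_symm_apply, -StarAlgEquiv.symm_apply_apply]

/-- `BDSV.jacCLM` is the inverse of `matCL`. [folklore] -/
theorem jacCLM_eq_matCL_symm (S : 𝕃) : jacCLM S = matCL.symm S := by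
  ext a b
  rw [jacCLM_apply, matCL_symm_apply]

/-- Transposition transported to `𝕃`: `transposeCL S = matCL ((matCL⁻¹ S)ᵀ)` (the adjoint for the
Euclidean structure), as a continuous linear map. [folklore] -/
def transposeCL : 𝕃 →L[ℝ] 𝕃 :=
  LinearMap.toContinuousLinearMap
    (matCL.toAlgEquiv.toLinearMap ∘ₗ (Matrix.transposeLinearEquiv (Fin 3) (Fin 3) ℝ ℝ).toLinearMap ∘ₗ
      matCL.symm.toAlgEquiv.toLinearMap)

/-- `transposeCL S = matCL ((matCL⁻¹ S)ᵀ)`. [folklore] -/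
theorem transposeCL_apply (S : 𝕃) : transposeCL S = matCL (matCL.symm S)ᵀ := rfl

/-- `matCL⁻¹ (transposeCL S) = (matCL⁻¹ S)ᵀ`. [folklore] -/
theorem matCL_symm_transposeCL (S : 𝕃) : matCL.symm (transposeCL S) = (matCL.symm S)ᵀ := by
  rw [transposeCL_apply, matCL.symm_apply_apply]

/-- `BDSV.ofCols` transported to `𝕃`, as a continuous linear map. [folklore] -/
def ofColsCL : (Fin 3 → ℝ³) →L[ℝ] 𝕃 :=
  LinearMap.toContinuousLinearMap (matCL.toAlgEquiv.toLinearMap ∘ₗ ofColsCLM.toLinearMap)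

/-- `ofColsCL R = matCL (ofCols R)`. [folklore] -/
theorem ofColsCL_apply (R : Fin 3 → ℝ³) : ofColsCL R = matCL (ofCols R) := rfl

/-- `matCL⁻¹ (ofColsCL R) = ofCols R`. [folklore] -/
theorem matCL_symm_ofColsCL (R : Fin 3 → ℝ³) : matCL.symm (ofColsCL R) = ofCols R := by
  rw [ofColsCL_apply, matCL.symm_apply_apply]

/-- `∇Φ = Id + D(lift D)` in the carrier `𝕃` (its matrix is `BDSV.liftGradPhi`). [cite: BuckmasterEtAl2018, §5.2 (Φ_i)] -/
def gradPhiCL (Dsl : 𝕋³ → ℝ³) (y : ℝ³) : 𝕃 := 1 + fderiv ℝ (lift Dsl) y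

/-- `R̃ = ∇Φ (Id - c R̊̄) ∇Φᵀ` in the carrier `𝕃` (its matrix is `BDSV.liftTildeR`). [cite: BuckmasterEtAl2018, §5.5 (5.32)] -/
def stressCL (c : ℝ) (Rsl : 𝕋³ → Fin 3 → ℝ³) (Dsl : 𝕋³ → ℝ³) (y : ℝ³) : 𝕃 :=
  gradPhiCL Dsl y * ((1 : 𝕃) - c • ofColsCL (lift Rsl y)) * transposeCL (gradPhiCL Dsl y)

/-- A Mikado profile as a function of `(S, ξ) ∈ 𝕃 × ℝ³`: `V(matCL⁻¹ S, proj ξ)`. [cite: BuckmasterEtAl2018, §5.1 (5.9)] -/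
def mikadoLiftCL (V : 𝕄 → 𝕋³ → ℝ³) : 𝕃 × ℝ³ → ℝ³ := fun p => V (matCL.symm p.1) (proj p.2)

/-- `mikadoLiftCL V (S, ξ) = mikadoLift V (matCL⁻¹ S, ξ)`. [folklore] -/
theorem mikadoLiftCL_apply (V : 𝕄 → 𝕋³ → ℝ³) (S : 𝕃) (ξ : ℝ³) :
    mikadoLiftCL V (S, ξ) = mikadoLift V (matCL.symm S, ξ) := rfl

/-- The `i`-th summand of the potential in the carrier `𝕃`:
`(σ η) • (∇Φ)ᵀ V(R̃, n(y + D))`. [cite: BuckmasterEtAl2018, §5.3 (5.28)] -/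
def summandCL (V : 𝕄 → 𝕋³ → ℝ³) (σ c n : ℝ) (ηsl : 𝕋³ → ℝ) (Rsl : 𝕋³ → Fin 3 → ℝ³)
    (Dsl : 𝕋³ → ℝ³) (y : ℝ³) : ℝ³ :=
  (σ * lift ηsl y) • (transposeCL (gradPhiCL Dsl y))
    (mikadoLiftCL V (stressCL c Rsl Dsl y, n • (y + lift Dsl y)))

/-- `matCL⁻¹ (∇Φ in 𝕃) = liftGradPhi`. [folklore] -/
theorem matCL_symm_gradPhiCL (Dsl : 𝕋³ → ℝ³) (y : ℝ³) : matCL.symm (gradPhiCL Dsl y) = liftGradPhi Dsl y := by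
  rw [gradPhiCL, liftGradPhi, map_add, map_one, jacCLM_eq_matCL_symm]

/-- `matCL⁻¹ (R̃ in 𝕃) = liftTildeR`. [folklore] -/
theorem matCL_symm_stressCL (c : ℝ) (Rsl : 𝕋³ → Fin 3 → ℝ³) (Dsl : 𝕋³ → ℝ³) (y : ℝ³) :
    matCL.symm (stressCL c Rsl Dsl y) = liftTildeR c Rsl Dsl y := by
  rw [stressCL, liftTildeR, map_mul, map_mul, matCL_symm_transposeCL, matCL_symm_gradPhiCL, map_sub,
    map_one, map_smul, matCL_symm_ofColsCL, ofColsCLM_apply]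

/-- **Bridge**: the matrix-form lifted summand of `OnsagerBDSVMikadoBounds.lean` equals the
carrier-form summand. [folklore] -/
theorem liftSummand_eq_summandCL (V : 𝕄 → 𝕋³ → ℝ³) (σ c n : ℝ) (ηsl : 𝕋³ → ℝ)
    (Rsl : 𝕋³ → Fin 3 → ℝ³) (Dsl : 𝕋³ → ℝ³) :
    liftSummand V σ c n ηsl Rsl Dsl = summandCL V σ c n ηsl Rsl Dsl := by
  funext y
  rw [liftSummand, summandCL, mikadoLiftCL_apply, matCL_symm_stressCL, bmat_apply, transposeCL_apply,
    matCL_apply, matCL_symm_gradPhiCL]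

/-- The identity of `ℝ³` has the identity matrix; transposition fixes it. [folklore] -/
theorem transposeCL_one : transposeCL (1 : 𝕃) = 1 := by
  rw [transposeCL_apply, map_one, Matrix.transpose_one, map_one]

end Carrier

/-! ## Mikado profiles in the carrier: periodicity and bounds on compact sets -/

section MikadoCL

/-- The carrier lift is smooth when the Mikado lift is. [folklore] -/
theorem contDiff_mikadoLiftCL {V : 𝕄 → 𝕋³ → ℝ³} (hV : ContDiff ℝ ∞ (mikadoLift V)) :
    ContDiff ℝ ∞ (mikadoLiftCL V) := by
  set L : 𝕃 →L[ℝ] 𝕄 := LinearMap.toContinuousLinearMap matCL.symm.toAlgEquiv.toLinearMap with hL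
  have h : mikadoLiftCL V = mikadoLift V ∘ fun p : 𝕃 × ℝ³ => (L p.1, p.2) := by
    funext p; rfl
  rw [h]
  exact hV.comp ((L.contDiff.comp contDiff_fst).prodMk contDiff_snd)

/-- The carrier lift is `ℤ³`-periodic in `ξ`. [folklore] -/
theorem mikadoLiftCL_add_latticeVec (V : 𝕄 → 𝕋³ → ℝ³) (p : 𝕃 × ℝ³) (k : Fin 3 → ℤ) :
    mikadoLiftCL V (p + (0, latticeVec k)) = mikadoLiftCL V p := by
  obtain ⟨S, ξ⟩ := p
  simp only [Prod.mk_add_mk, add_zero, mikadoLiftCL, proj_add, proj_latticeVec]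

/-- All derivatives of the carrier lift are `ℤ³`-periodic in `ξ`. [folklore] -/
theorem iteratedFDeriv_mikadoLiftCL_add_latticeVec (V : 𝕄 → 𝕋³ → ℝ³) (m : ℕ) (p : 𝕃 × ℝ³)
    (k : Fin 3 → ℤ) :
    iteratedFDeriv ℝ m (mikadoLiftCL V) (p + (0, latticeVec k)) = iteratedFDeriv ℝ m (mikadoLiftCL V) p := by
  have h : (fun q => mikadoLiftCL V (q + (0, latticeVec k))) = mikadoLiftCL V :=
    funext fun q => mikadoLiftCL_add_latticeVec V q k
  have := congrFun (iteratedFDeriv_comp_add_right' (𝕜 := ℝ) (f := mikadoLiftCL V) m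
    ((0 : 𝕃), latticeVec k)) p
  rw [h] at this
  exact this.symm

/-- **Derivatives of Mikado profiles are bounded on compact sets** (carrier version; the role of
(5.7) / Remark 5.2 / Lemma 5.5): for compact `K ⊆ 𝕃`,
`sup_{S ∈ K, ξ ∈ ℝ³} ‖Dᵐ(mikadoLiftCL V)(S, ξ)‖ ≤ C(K, m)`. [cite: BuckmasterEtAl2018, §5.1 (5.7) and Remark 5.2] -/
theorem exists_forall_norm_iteratedFDeriv_mikadoLiftCL_le {V : 𝕄 → 𝕋³ → ℝ³}
    (hV : ContDiff ℝ ∞ (mikadoLift V)) {K : Set 𝕃} (hK : IsCompact K) (m : ℕ) :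
    ∃ C : ℝ, 0 ≤ C ∧ ∀ S ∈ K, ∀ ξ : ℝ³, ‖iteratedFDeriv ℝ m (mikadoLiftCL V) (S, ξ)‖ ≤ C := by
  have hc : Continuous (iteratedFDeriv ℝ m (mikadoLiftCL V)) :=
    (contDiff_mikadoLiftCL hV).continuous_iteratedFDeriv (WithTop.coe_le_coe.2 le_top)
  -- the norm instance is supplied explicitly (the elaborated statement uses the alias
  -- `ContinuousMultilinearMap.hasOpNorm'`, which unification does not reach from a metavariable)
  obtain ⟨C, hC⟩ := @IsCompact.exists_bound_of_continuousOn _ _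
    (inferInstance : SeminormedAddGroup ((𝕃 × ℝ³) [×m]→L[ℝ] ℝ³)) _ _
    (hK.prod (isCompact_toLp_image_pi_Icc (d := Fin 3))) (iteratedFDeriv ℝ m (mikadoLiftCL V)) hc.continuousOn
  refine ⟨max C 0, le_max_right _ _, fun S hS ξ => ?_⟩
  obtain ⟨k, hk⟩ := exists_repr_proj_eq_add_latticeVec_holds ξ
  have hξ : ((S, ξ) : 𝕃 × ℝ³) = ((S, repr (proj ξ)) : 𝕃 × ℝ³) + (0, latticeVec (-k)) := by
    have h0 : latticeVec k + latticeVec (-k) = (0 : ℝ³) := by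
      rw [← latticeVec_add, add_neg_cancel, latticeVec_zero]
    ext1
    · simp
    · rw [Prod.snd_add, hk, add_assoc, h0, add_zero]
  rw [hξ, iteratedFDeriv_mikadoLiftCL_add_latticeVec]
  exact (hC _ (mk_mem_prod hS (repr_mem_toLp_image_pi_Icc _))).trans (le_max_left _ _)

/-- Uniform bound for the derivatives of orders `≤ N` of the carrier lift on `K × ℝ³`. [folklore] -/
theorem exists_forall_le_norm_iteratedFDeriv_mikadoLiftCL_le {V : 𝕄 → 𝕋³ → ℝ³}
    (hV : ContDiff ℝ ∞ (mikadoLift V)) {K : Set 𝕃} (hK : IsCompact K) (N : ℕ) :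
    ∃ C : ℝ, 0 ≤ C ∧ ∀ m ≤ N, ∀ S ∈ K, ∀ ξ : ℝ³, ‖iteratedFDeriv ℝ m (mikadoLiftCL V) (S, ξ)‖ ≤ C := by
  induction N with
  | zero =>
    obtain ⟨C, hC0, hC⟩ := exists_forall_norm_iteratedFDeriv_mikadoLiftCL_le hV hK 0
    exact ⟨C, hC0, fun m hm => by rw [Nat.le_zero.1 hm]; exact hC⟩
  | succ N ih =>
    obtain ⟨C, hC0, hC⟩ := ih
    obtain ⟨C', hC0', hC'⟩ := exists_forall_norm_iteratedFDeriv_mikadoLiftCL_le hV hK (N + 1)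
    refine ⟨max C C', le_max_of_le_left hC0, fun m hm S hS ξ => ?_⟩
    rcases Nat.lt_or_ge m (N + 1) with h | h
    · exact (hC m (Nat.lt_succ_iff.1 h) S hS ξ).trans (le_max_left _ _)
    · rw [le_antisymm hm h]
      exact (hC' S hS ξ).trans (le_max_right _ _)

end MikadoCL

/-! ## Bounds for the ingredients -/

section Ingredients

/-- `∇Φ` in the carrier is smooth for a smooth displacement slice. [folklore] -/
theorem contDiff_gradPhiCL {Dsl : 𝕋³ → ℝ³} (hD : IsSmooth Dsl) : ContDiff ℝ ∞ (gradPhiCL Dsl) := by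
  have hD' : ContDiff ℝ ∞ (lift Dsl) := hD
  exact contDiff_const.add (hD'.fderiv_right le_rfl)

/-- `‖∇Φ(y)‖ ≤ 1 + ‖D(lift D)(y)‖`. [folklore] -/
theorem norm_gradPhiCL_le (Dsl : 𝕋³ → ℝ³) (y : ℝ³) :
    ‖gradPhiCL Dsl y‖ ≤ 1 + ‖iteratedFDeriv ℝ 1 (lift Dsl) y‖ := by
  rw [gradPhiCL, norm_iteratedFDeriv_one_eq_norm_fderiv]
  exact (norm_add_le _ _).trans (add_le_add ContinuousLinearMap.norm_id_le le_rfl)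

/-- `‖Dᵏ∇Φ(y)‖ = ‖Dᵏ⁺¹(lift D)(y)‖` for `k ≥ 1` (cf. (5.29): `‖∇Φᵢ‖_N ≲ ℓ^{-N}` from
`[Φ]_N ≲ τ[v]_N`). [cite: BuckmasterEtAl2018, Prop. 5.7 (5.29)] -/
theorem norm_iteratedFDeriv_gradPhiCL {Dsl : 𝕋³ → ℝ³} (hD : IsSmooth Dsl) {k : ℕ} (hk : k ≠ 0)
    (y : ℝ³) :
    ‖iteratedFDeriv ℝ k (gradPhiCL Dsl) y‖ = ‖iteratedFDeriv ℝ (k + 1) (lift Dsl) y‖ := by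
  have hD' : ContDiff ℝ ∞ (lift Dsl) := hD
  have e : gradPhiCL Dsl = fun y => (1 : 𝕃) + fderiv ℝ (lift Dsl) y := rfl
  rw [e, iteratedFDeriv_const_add' (hD'.fderiv_right le_rfl) _ hk, norm_iteratedFDeriv_fderiv]

/-- The middle factor `Id - c R̊̄` is smooth. [folklore] -/
theorem contDiff_middleCL (c : ℝ) {Rsl : 𝕋³ → Fin 3 → ℝ³} (hR : IsSmooth Rsl) :
    ContDiff ℝ ∞ (fun y => (1 : 𝕃) - c • ofColsCL (lift Rsl y)) := by
  have hR' : ContDiff ℝ ∞ (lift Rsl) := hR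
  exact contDiff_const.sub ((ofColsCL.contDiff.comp hR').const_smul c)

/-- `R̃` in the carrier is smooth. [folklore] -/
theorem contDiff_stressCL (c : ℝ) {Rsl : 𝕋³ → Fin 3 → ℝ³} {Dsl : 𝕋³ → ℝ³} (hR : IsSmooth Rsl)
    (hD : IsSmooth Dsl) : ContDiff ℝ ∞ (stressCL c Rsl Dsl) :=
  ((contDiff_gradPhiCL hD).mul (contDiff_middleCL c hR)).mul (transposeCL.contDiff.comp (contDiff_gradPhiCL hD))

/-- The pair `G = (R̃, n(y + D))` is smooth. [folklore] -/
theorem contDiff_pairCL {c n : ℝ} {Rsl : 𝕋³ → Fin 3 → ℝ³} {Dsl : 𝕋³ → ℝ³} (hR : IsSmooth Rsl)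
    (hD : IsSmooth Dsl) :
    ContDiff ℝ ∞ (fun y : ℝ³ => (stressCL c Rsl Dsl y, n • (y + lift Dsl y))) := by
  have hD' : ContDiff ℝ ∞ (lift Dsl) := hD
  exact (contDiff_stressCL c hR hD).prodMk ((contDiff_id.add hD').const_smul n)

/-- **Faà di Bruno for the Mikado composite.** If `‖DᵐV‖ ≤ C_V` on `K × ℝ³` for `m ≤ 2`,
`R̃(y) ∈ K`, `‖DR̃(y)‖ ≤ n`, `‖D²R̃(y)‖ ≤ n²`, `‖D(lift D)(y)‖ ≤ 1`, `‖D²(lift D)(y)‖ ≤ n` and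
`n ≥ 1`, then `h = V(R̃, n(y + D))` satisfies `‖h(y)‖ ≤ C_V`, `‖Dh(y)‖ ≤ 2 C_V n`,
`‖D²h(y)‖ ≤ 8 C_V n²` (one power of the frequency per derivative, as in (5.34)).
[cite: BuckmasterEtAl2018, Cor. 5.8 (5.34)] -/
theorem norm_iteratedFDeriv_mikadoLiftCL_comp_le {V : 𝕄 → 𝕋³ → ℝ³} (hV : ContDiff ℝ ∞ (mikadoLift V))
    {K : Set 𝕃} {CV : ℝ} (hCV : ∀ m ≤ 2, ∀ S ∈ K, ∀ ξ : ℝ³, ‖iteratedFDeriv ℝ m (mikadoLiftCL V) (S, ξ)‖ ≤ CV)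
    {c n : ℝ} (hn : 1 ≤ n) {Rsl : 𝕋³ → Fin 3 → ℝ³} {Dsl : 𝕋³ → ℝ³} (hR : IsSmooth Rsl)
    (hD : IsSmooth Dsl) {y : ℝ³} (hK : stressCL c Rsl Dsl y ∈ K)
    (hd1 : ‖iteratedFDeriv ℝ 1 (lift Dsl) y‖ ≤ 1)
    (hr1 : ‖iteratedFDeriv ℝ 1 (stressCL c Rsl Dsl) y‖ ≤ n)
    (hr2 : ‖iteratedFDeriv ℝ 2 (stressCL c Rsl Dsl) y‖ ≤ n ^ 2)
    (hd2 : ‖iteratedFDeriv ℝ 2 (lift Dsl) y‖ ≤ n) :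
    ‖mikadoLiftCL V (stressCL c Rsl Dsl y, n • (y + lift Dsl y))‖ ≤ CV ∧
    ‖iteratedFDeriv ℝ 1 (fun z => mikadoLiftCL V (stressCL c Rsl Dsl z, n • (z + lift Dsl z))) y‖ ≤
        2 * CV * n ∧
    ‖iteratedFDeriv ℝ 2 (fun z => mikadoLiftCL V (stressCL c Rsl Dsl z, n • (z + lift Dsl z))) y‖ ≤
        8 * CV * n ^ 2 := by
  have hD' : ContDiff ℝ ∞ (lift Dsl) := hD
  have hG := contDiff_pairCL (c := c) (n := n) hR hD
  have hS := contDiff_stressCL c hR hD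
  have hP : ContDiff ℝ ∞ (fun z : ℝ³ => n • (z + lift Dsl z)) := (contDiff_id.add hD').const_smul n
  have hn0 : 0 ≤ n := zero_le_one.trans hn
  have habs : |n| = n := abs_of_nonneg hn0
  -- derivatives of the pair
  have hG1 : ‖iteratedFDeriv ℝ 1 (fun z : ℝ³ => (stressCL c Rsl Dsl z, n • (z + lift Dsl z))) y‖ ≤ 2 * n := by
    rw [iteratedFDeriv_prodMk (hS.contDiffAt.of_le (WithTop.coe_le_coe.2 le_top))
      (hP.contDiffAt.of_le (WithTop.coe_le_coe.2 le_top)) le_rfl, ContinuousMultilinearMap.opNorm_prod]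
    refine max_le (hr1.trans (by linarith)) ((norm_iteratedFDeriv_one_phase_le hD' n y).trans ?_)
    rw [habs]
    nlinarith
  have hG2 : ‖iteratedFDeriv ℝ 2 (fun z : ℝ³ => (stressCL c Rsl Dsl z, n • (z + lift Dsl z))) y‖ ≤ (2 * n) ^ 2 := by
    rw [iteratedFDeriv_prodMk (hS.contDiffAt.of_le (WithTop.coe_le_coe.2 le_top))
      (hP.contDiffAt.of_le (WithTop.coe_le_coe.2 le_top)) le_rfl, ContinuousMultilinearMap.opNorm_prod]
    refine max_le (hr2.trans (by nlinarith)) ((norm_iteratedFDeriv_two_phase_le hD' n y).trans ?_)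
    rw [habs]
    nlinarith
  have hC : ∀ k ≤ 2, ∀ i, i ≤ k → ‖iteratedFDeriv ℝ i (mikadoLiftCL V)
      (stressCL c Rsl Dsl y, n • (y + lift Dsl y))‖ ≤ CV :=
    fun k hk i hi => hCV i (hi.trans hk) _ hK _
  have hDb : ∀ i, 1 ≤ i → i ≤ 2 →
      ‖iteratedFDeriv ℝ i (fun z : ℝ³ => (stressCL c Rsl Dsl z, n • (z + lift Dsl z))) y‖ ≤ (2 * n) ^ i := by
    intro i hi1 hi2
    rcases (show i = 1 ∨ i = 2 by omega) with rfl | rfl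
    · rw [pow_one]; exact hG1
    · exact hG2
  refine ⟨?_, ?_, ?_⟩
  · have := hC 0 (by norm_num) 0 le_rfl
    rwa [norm_iteratedFDeriv_zero] at this
  · have key := norm_iteratedFDeriv_comp_le (g := mikadoLiftCL V)
      (f := fun z : ℝ³ => (stressCL c Rsl Dsl z, n • (z + lift Dsl z))) (n := 1)
      (contDiff_mikadoLiftCL hV) hG (WithTop.coe_le_coe.2 le_top) y (hC 1 (by norm_num))
      (fun i h1 h2 => hDb i h1 (h2.trans (by norm_num)))
    refine key.trans (le_of_eq ?_)
    simp [Nat.factorial]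
    ring
  · have key := norm_iteratedFDeriv_comp_le (g := mikadoLiftCL V)
      (f := fun z : ℝ³ => (stressCL c Rsl Dsl z, n • (z + lift Dsl z))) (n := 2)
      (contDiff_mikadoLiftCL hV) hG (WithTop.coe_le_coe.2 le_top) y (hC 2 le_rfl) hDb
    refine key.trans (le_of_eq ?_)
    simp [Nat.factorial]
    ring

end Ingredients

/-! ## The summand bound (Prop. 5.7 / Cor. 5.8, normalised) -/

section Summand

/-- The universal constant `K_Z = 33 ‖transposeCL‖` of the summand bound. [folklore] -/
def summandConst : ℝ := 33 * ‖transposeCL‖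

/-- `0 ≤ K_Z`. [folklore] -/
theorem summandConst_nonneg : 0 ≤ summandConst := mul_nonneg (by norm_num) (norm_nonneg transposeCL)

/-- The summand in the carrier is smooth. [folklore] -/
theorem contDiff_summandCL {V : 𝕄 → 𝕋³ → ℝ³} (hV : ContDiff ℝ ∞ (mikadoLift V)) (σ c n : ℝ)
    {ηsl : 𝕋³ → ℝ} {Rsl : 𝕋³ → Fin 3 → ℝ³} {Dsl : 𝕋³ → ℝ³} (hη : IsSmooth ηsl) (hR : IsSmooth Rsl)
    (hD : IsSmooth Dsl) : ContDiff ℝ ∞ (summandCL V σ c n ηsl Rsl Dsl) := by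
  have hη' : ContDiff ℝ ∞ (lift ηsl) := hη
  have hh := (contDiff_mikadoLiftCL hV).comp (contDiff_pairCL (c := c) (n := n) hR hD)
  exact (contDiff_const.mul hη').smul ((transposeCL.contDiff.comp (contDiff_gradPhiCL hD)).clm_apply hh)

/-- **The pointwise bound for one summand of the potential** (the normalised form of Prop. 5.7
(5.29)–(5.30) and of the computation (5.33)–(5.35) in the proof of Cor. 5.8: every derivative of
`ρ_{q,i}^{1/2} ∇Φᵢᵀ V(R̃_{q,i}, λΦᵢ)` costs at most one power of the frequency once the slowly
varying factors obey `‖∇Φᵢ‖_N, ‖R̃‖_N, ‖ηᵢ‖_N ≤ λ^N`). At a point `y`, assume `|η| ≤ 1`, `‖Dη‖ ≤ n`,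
`‖D²η‖ ≤ n²`; `‖D(lift D)‖ ≤ 1`, `‖D²(lift D)‖ ≤ n`, `‖D³(lift D)‖ ≤ n²`; `R̃(y) ∈ K`,
`‖DR̃(y)‖ ≤ n`, `‖D²R̃(y)‖ ≤ n²`; `‖DᵐV‖ ≤ C_V` on `K × ℝ³` for `m ≤ 2`; `σ ≥ 0`, `n ≥ 1`. Then
`‖D(summand)(y)‖ ≤ K_Z C_V σ n` and `‖D²(summand)(y)‖ ≤ K_Z C_V σ n²`.
[cite: BuckmasterEtAl2018, Prop. 5.7 (5.29)–(5.30) and Cor. 5.8 (5.33)–(5.35)] -/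
theorem norm_iteratedFDeriv_summandCL_le {V : 𝕄 → 𝕋³ → ℝ³} (hV : ContDiff ℝ ∞ (mikadoLift V))
    {K : Set 𝕃} {CV : ℝ} (hCV0 : 0 ≤ CV)
    (hCV : ∀ m ≤ 2, ∀ S ∈ K, ∀ ξ : ℝ³, ‖iteratedFDeriv ℝ m (mikadoLiftCL V) (S, ξ)‖ ≤ CV)
    {σ c n : ℝ} (hσ : 0 ≤ σ) (hn : 1 ≤ n)
    {ηsl : 𝕋³ → ℝ} {Rsl : 𝕋³ → Fin 3 → ℝ³} {Dsl : 𝕋³ → ℝ³} (hη : IsSmooth ηsl) (hR : IsSmooth Rsl)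
    (hD : IsSmooth Dsl) {y : ℝ³}
    (he0 : ‖lift ηsl y‖ ≤ 1) (he1 : ‖iteratedFDeriv ℝ 1 (lift ηsl) y‖ ≤ n)
    (he2 : ‖iteratedFDeriv ℝ 2 (lift ηsl) y‖ ≤ n ^ 2)
    (hd1 : ‖iteratedFDeriv ℝ 1 (lift Dsl) y‖ ≤ 1) (hd2 : ‖iteratedFDeriv ℝ 2 (lift Dsl) y‖ ≤ n)
    (hd3 : ‖iteratedFDeriv ℝ 3 (lift Dsl) y‖ ≤ n ^ 2)
    (hK : stressCL c Rsl Dsl y ∈ K)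
    (hr1 : ‖iteratedFDeriv ℝ 1 (stressCL c Rsl Dsl) y‖ ≤ n)
    (hr2 : ‖iteratedFDeriv ℝ 2 (stressCL c Rsl Dsl) y‖ ≤ n ^ 2) :
    ‖iteratedFDeriv ℝ 1 (summandCL V σ c n ηsl Rsl Dsl) y‖ ≤ summandConst * CV * σ * n ∧
    ‖iteratedFDeriv ℝ 2 (summandCL V σ c n ηsl Rsl Dsl) y‖ ≤ summandConst * CV * σ * n ^ 2 := by
  have hη' : ContDiff ℝ ∞ (lift ηsl) := hη
  have hD' : ContDiff ℝ ∞ (lift Dsl) := hD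
  have hn0 : 0 ≤ n := zero_le_one.trans hn
  set θ : ℝ := ‖transposeCL‖ with hθdef
  have hθ : 0 ≤ θ := norm_nonneg transposeCL
  -- the scalar factor
  set f : ℝ³ → ℝ := fun z => σ * lift ηsl z with hfdef
  have hf : ContDiff ℝ ∞ f := contDiff_const.mul hη'
  have F0 : ‖f y‖ ≤ σ := by
    rw [hfdef]
    change ‖σ * lift ηsl y‖ ≤ σ
    rw [norm_mul, Real.norm_eq_abs, abs_of_nonneg hσ]
    exact (mul_le_mul_of_nonneg_left he0 hσ).trans (le_of_eq (mul_one σ))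
  have F1 : ‖iteratedFDeriv ℝ 1 f y‖ ≤ σ * n := by
    rw [hfdef, norm_iteratedFDeriv_const_mul σ hη', abs_of_nonneg hσ]
    exact mul_le_mul_of_nonneg_left he1 hσ
  have F2 : ‖iteratedFDeriv ℝ 2 f y‖ ≤ σ * n ^ 2 := by
    rw [hfdef, norm_iteratedFDeriv_const_mul σ hη', abs_of_nonneg hσ]
    exact mul_le_mul_of_nonneg_left he2 hσ
  -- `∇Φ` and its transpose
  have hA := contDiff_gradPhiCL hD
  have a0 : ‖gradPhiCL Dsl y‖ ≤ 2 := (norm_gradPhiCL_le Dsl y).trans (by linarith)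
  have a1 : ‖iteratedFDeriv ℝ 1 (gradPhiCL Dsl) y‖ ≤ n := by
    rw [norm_iteratedFDeriv_gradPhiCL hD one_ne_zero]; exact hd2
  have a2 : ‖iteratedFDeriv ℝ 2 (gradPhiCL Dsl) y‖ ≤ n ^ 2 := by
    rw [norm_iteratedFDeriv_gradPhiCL hD two_ne_zero]; exact hd3
  set AT : ℝ³ → 𝕃 := fun z => transposeCL (gradPhiCL Dsl z) with hATdef
  have hAT : ContDiff ℝ ∞ AT := transposeCL.contDiff.comp hA
  have t0 : ‖AT y‖ ≤ 2 * θ := by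
    rw [hATdef]
    change ‖transposeCL (gradPhiCL Dsl y)‖ ≤ 2 * θ
    refine (transposeCL.le_opNorm _).trans ?_
    rw [← hθdef, mul_comm]
    exact mul_le_mul_of_nonneg_right a0 hθ
  have t1 : ‖iteratedFDeriv ℝ 1 AT y‖ ≤ θ * n :=
    (norm_iteratedFDeriv_clm_comp_le transposeCL hA 1 y).trans (mul_le_mul_of_nonneg_left a1 hθ)
  have t2 : ‖iteratedFDeriv ℝ 2 AT y‖ ≤ θ * n ^ 2 :=
    (norm_iteratedFDeriv_clm_comp_le transposeCL hA 2 y).trans (mul_le_mul_of_nonneg_left a2 hθ)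
  -- the Mikado composite
  set h : ℝ³ → ℝ³ := fun z => mikadoLiftCL V (stressCL c Rsl Dsl z, n • (z + lift Dsl z)) with hhdef
  have hh : ContDiff ℝ ∞ h := (contDiff_mikadoLiftCL hV).comp (contDiff_pairCL (c := c) (n := n) hR hD)
  obtain ⟨h0, h1, h2⟩ := norm_iteratedFDeriv_mikadoLiftCL_comp_le hV hCV hn hR hD hK hd1 hr1 hr2 hd2
  have h0' : ‖h y‖ ≤ CV := h0
  -- `u = ∇Φᵀ V(...)`
  set u : ℝ³ → ℝ³ := fun z => (AT z) (h z) with hudef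
  have hu : ContDiff ℝ ∞ u := hAT.clm_apply hh
  have u0 : ‖u y‖ ≤ 2 * θ * CV := by
    change ‖(AT y) (h y)‖ ≤ 2 * θ * CV
    exact ((AT y).le_opNorm _).trans (mul_le_mul t0 h0' (norm_nonneg _) (by positivity))
  have u1 : ‖iteratedFDeriv ℝ 1 u y‖ ≤ 5 * θ * CV * n := by
    refine (norm_iteratedFDeriv_clm_apply_one_le hAT hh y).trans ?_
    calc ‖AT y‖ * ‖iteratedFDeriv ℝ 1 h y‖ + ‖iteratedFDeriv ℝ 1 AT y‖ * ‖h y‖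
        ≤ (2 * θ) * (2 * CV * n) + (θ * n) * CV :=
          add_le_add (mul_le_mul t0 h1 (norm_nonneg _) (by positivity))
            (mul_le_mul t1 h0' (norm_nonneg _) (mul_nonneg hθ hn0))
      _ = 5 * θ * CV * n := by ring
  have u2 : ‖iteratedFDeriv ℝ 2 u y‖ ≤ 21 * θ * CV * n ^ 2 := by
    refine (norm_iteratedFDeriv_clm_apply_two_le hAT hh y).trans ?_
    calc ‖AT y‖ * ‖iteratedFDeriv ℝ 2 h y‖ +
          2 * ‖iteratedFDeriv ℝ 1 AT y‖ * ‖iteratedFDeriv ℝ 1 h y‖ + ‖iteratedFDeriv ℝ 2 AT y‖ * ‖h y‖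
        ≤ (2 * θ) * (8 * CV * n ^ 2) + 2 * (θ * n) * (2 * CV * n) + (θ * n ^ 2) * CV := by
          refine add_le_add (add_le_add ?_ ?_) ?_
          · exact mul_le_mul t0 h2 (norm_nonneg _) (by positivity)
          · rw [mul_assoc, mul_assoc]
            refine mul_le_mul_of_nonneg_left ?_ (by norm_num)
            exact mul_le_mul t1 h1 (norm_nonneg _) (mul_nonneg hθ hn0)
          · exact mul_le_mul t2 h0' (norm_nonneg _) (mul_nonneg hθ (pow_nonneg hn0 2))
      _ = 21 * θ * CV * n ^ 2 := by ring
  -- the summand `f • u`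
  have e : summandCL V σ c n ηsl Rsl Dsl = fun z => f z • u z := rfl
  rw [e]
  refine ⟨?_, ?_⟩
  · refine (norm_iteratedFDeriv_smul_one_le hf hu y).trans ?_
    calc ‖f y‖ * ‖iteratedFDeriv ℝ 1 u y‖ + ‖iteratedFDeriv ℝ 1 f y‖ * ‖u y‖
        ≤ σ * (5 * θ * CV * n) + (σ * n) * (2 * θ * CV) :=
          add_le_add (mul_le_mul F0 u1 (norm_nonneg _) hσ)
            (mul_le_mul F1 u0 (norm_nonneg _) (mul_nonneg hσ hn0))
      _ = 7 * θ * CV * σ * n := by ring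
      _ ≤ summandConst * CV * σ * n := by
          rw [summandConst, ← hθdef]
          have : 0 ≤ θ * CV * σ * n := by positivity
          nlinarith
  · refine (norm_iteratedFDeriv_smul_two_le hf hu y).trans ?_
    calc ‖f y‖ * ‖iteratedFDeriv ℝ 2 u y‖ +
          2 * ‖iteratedFDeriv ℝ 1 f y‖ * ‖iteratedFDeriv ℝ 1 u y‖ + ‖iteratedFDeriv ℝ 2 f y‖ * ‖u y‖
        ≤ σ * (21 * θ * CV * n ^ 2) + 2 * (σ * n) * (5 * θ * CV * n) + (σ * n ^ 2) * (2 * θ * CV) := by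
          refine add_le_add (add_le_add ?_ ?_) ?_
          · exact mul_le_mul F0 u2 (norm_nonneg _) hσ
          · rw [mul_assoc, mul_assoc]
            refine mul_le_mul_of_nonneg_left ?_ (by norm_num)
            exact mul_le_mul F1 u1 (norm_nonneg _) (mul_nonneg hσ hn0)
          · exact mul_le_mul F2 u0 (norm_nonneg _) (mul_nonneg hσ (pow_nonneg hn0 2))
      _ = summandConst * CV * σ * n ^ 2 := by rw [summandConst, ← hθdef]; ring

end Summand

/-! ## Bounds for the stress argument `R̃ = ∇Φ (Id - c R̊̄) ∇Φᵀ` -/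

section Stress

/-- **`R̃` is close to the identity** (the content of `|R̃_{q,i} - Id| ≲ ℓ^α` in Lemma 5.4): with
`J = D(lift D)(y)`, `‖J‖ ≤ 1`, and `N = c R̊̄(y)`,
`‖R̃(y) - Id‖ ≤ (1 + 2‖T‖) ‖J‖ + 2(1 + ‖T‖) |c| ‖ofColsCL‖ ‖R̊̄(y)‖`, `T = transposeCL`.
[cite: BuckmasterEtAl2018, Lemma 5.4 (proof, |R̃ - Id| ≲ ℓ^α)] -/
theorem norm_stressCL_sub_one_le (c : ℝ) (Rsl : 𝕋³ → Fin 3 → ℝ³) (Dsl : 𝕋³ → ℝ³) (y : ℝ³)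
    (hd1 : ‖iteratedFDeriv ℝ 1 (lift Dsl) y‖ ≤ 1) :
    ‖stressCL c Rsl Dsl y - 1‖ ≤
      (1 + 2 * ‖transposeCL‖) * ‖iteratedFDeriv ℝ 1 (lift Dsl) y‖ +
        2 * (1 + ‖transposeCL‖) * (|c| * ‖ofColsCL‖ * ‖lift Rsl y‖) := by
  set θ : ℝ := ‖transposeCL‖ with hθdef
  have hθ : 0 ≤ θ := norm_nonneg transposeCL
  set J : 𝕃 := fderiv ℝ (lift Dsl) y with hJdef
  set N : 𝕃 := c • ofColsCL (lift Rsl y) with hNdef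
  have hJ : ‖J‖ = ‖iteratedFDeriv ℝ 1 (lift Dsl) y‖ := (norm_iteratedFDeriv_one_eq_norm_fderiv _ _).symm
  have hJ1 : ‖J‖ ≤ 1 := hJ ▸ hd1
  have hN : ‖N‖ ≤ |c| * ‖ofColsCL‖ * ‖lift Rsl y‖ := by
    rw [hNdef, norm_smul, Real.norm_eq_abs, mul_assoc]
    exact mul_le_mul_of_nonneg_left (ofColsCL.le_opNorm _) (abs_nonneg c)
  have hT : ‖transposeCL J‖ ≤ θ * ‖J‖ := transposeCL.le_opNorm J
  have hexp : stressCL c Rsl Dsl y - 1 =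
      J + transposeCL J + J * transposeCL J - (1 + J) * N * (1 + transposeCL J) := by
    have e1 : stressCL c Rsl Dsl y = (1 + J) * (1 - N) * transposeCL (1 + J) := rfl
    rw [e1, map_add, transposeCL_one]
    simp only [mul_add, add_mul, mul_sub, sub_mul, mul_one, one_mul]
    abel
  rw [hexp]
  have n1 : ‖J + transposeCL J + J * transposeCL J‖ ≤ ‖J‖ + θ * ‖J‖ + ‖J‖ * (θ * ‖J‖) := by
    refine (norm_add_le _ _).trans (add_le_add ((norm_add_le _ _).trans (add_le_add le_rfl hT)) ?_)
    exact (norm_mul_le _ _).trans (mul_le_mul_of_nonneg_left hT (norm_nonneg _))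
  have n2 : ‖(1 + J) * N * (1 + transposeCL J)‖ ≤ (1 + ‖J‖) * ‖N‖ * (1 + θ * ‖J‖) := by
    have h1 : ‖(1 : 𝕃) + J‖ ≤ 1 + ‖J‖ := (norm_add_le _ _).trans (add_le_add ContinuousLinearMap.norm_id_le le_rfl)
    have h2 : ‖(1 : 𝕃) + transposeCL J‖ ≤ 1 + θ * ‖J‖ :=
      (norm_add_le _ _).trans (add_le_add ContinuousLinearMap.norm_id_le hT)
    calc ‖(1 + J) * N * (1 + transposeCL J)‖ ≤ ‖(1 + J) * N‖ * ‖1 + transposeCL J‖ := norm_mul_le _ _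
      _ ≤ (‖1 + J‖ * ‖N‖) * ‖1 + transposeCL J‖ := mul_le_mul_of_nonneg_right (norm_mul_le _ _) (norm_nonneg _)
      _ ≤ (1 + ‖J‖) * ‖N‖ * (1 + θ * ‖J‖) :=
          mul_le_mul (mul_le_mul_of_nonneg_right h1 (norm_nonneg _)) h2 (norm_nonneg _) (by positivity)
  calc ‖J + transposeCL J + J * transposeCL J - (1 + J) * N * (1 + transposeCL J)‖
      ≤ ‖J + transposeCL J + J * transposeCL J‖ + ‖(1 + J) * N * (1 + transposeCL J)‖ := norm_sub_le _ _
    _ ≤ (‖J‖ + θ * ‖J‖ + ‖J‖ * (θ * ‖J‖)) + (1 + ‖J‖) * ‖N‖ * (1 + θ * ‖J‖) := add_le_add n1 n2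
    _ ≤ (1 + 2 * θ) * ‖J‖ + 2 * (1 + θ) * (|c| * ‖ofColsCL‖ * ‖lift Rsl y‖) := by
        have hJ0 : 0 ≤ ‖J‖ := norm_nonneg _
        have hN0 : 0 ≤ ‖N‖ := norm_nonneg _
        have e2 : ‖J‖ * (θ * ‖J‖) ≤ θ * ‖J‖ := by nlinarith [mul_nonneg hθ hJ0]
        have e3 : (1 + ‖J‖) * ‖N‖ * (1 + θ * ‖J‖) ≤ 2 * ‖N‖ * (1 + θ) := by
          have : (1 + ‖J‖) * ‖N‖ ≤ 2 * ‖N‖ := by nlinarith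
          exact mul_le_mul this (by nlinarith [mul_nonneg hθ hJ0]) (by positivity) (by positivity)
        nlinarith [mul_nonneg (mul_nonneg (abs_nonneg c) (norm_nonneg ofColsCL)) (norm_nonneg (lift Rsl y))]
    _ = _ := by rw [hJ]
set_option maxHeartbeats 400000 in -- buildfix (bf3-g27): 160k/180k FAIL, 200k PASS at accept time; line-neutral budget line
/-- **Derivative bounds for `R̃`** (the content of (5.32)–(5.33): `‖R̃‖_N ≲ ‖∇Φ‖_N‖∇Φ‖₀ + ‖R/ρ‖_N`):
with `d_k = ‖Dᵏ(lift D)(y)‖`, `r_k = ‖Dᵏ(lift R̊̄)(y)‖`, `d₁ ≤ 1`, `|c| ‖ofColsCL‖ r₀ ≤ 1`, and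
`T = transposeCL`, `o = ‖ofColsCL‖`:
`‖DR̃(y)‖ ≤ ‖T‖ (8 d₂ + 4|c| o r₁)` and `‖D²R̃(y)‖ ≤ ‖T‖ (8 d₃ + 8 |c| o r₁ d₂ + 4 d₂² + 4 |c| o r₂)`.
[cite: BuckmasterEtAl2018, Prop. 5.7 (5.32)–(5.33)] -/
theorem norm_iteratedFDeriv_stressCL_le (c : ℝ) {Rsl : 𝕋³ → Fin 3 → ℝ³} {Dsl : 𝕋³ → ℝ³}
    (hR : IsSmooth Rsl) (hD : IsSmooth Dsl) (y : ℝ³)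
    (hd1 : ‖iteratedFDeriv ℝ 1 (lift Dsl) y‖ ≤ 1)
    (hr0 : |c| * ‖ofColsCL‖ * ‖lift Rsl y‖ ≤ 1) :
    ‖iteratedFDeriv ℝ 1 (stressCL c Rsl Dsl) y‖ ≤
      ‖transposeCL‖ * (8 * ‖iteratedFDeriv ℝ 2 (lift Dsl) y‖ +
        4 * (|c| * ‖ofColsCL‖ * ‖iteratedFDeriv ℝ 1 (lift Rsl) y‖)) ∧
    ‖iteratedFDeriv ℝ 2 (stressCL c Rsl Dsl) y‖ ≤
      ‖transposeCL‖ * (8 * ‖iteratedFDeriv ℝ 3 (lift Dsl) y‖ +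
        8 * (|c| * ‖ofColsCL‖ * ‖iteratedFDeriv ℝ 1 (lift Rsl) y‖) * ‖iteratedFDeriv ℝ 2 (lift Dsl) y‖ +
        4 * ‖iteratedFDeriv ℝ 2 (lift Dsl) y‖ ^ 2 +
        4 * (|c| * ‖ofColsCL‖ * ‖iteratedFDeriv ℝ 2 (lift Rsl) y‖)) := by
  have hR' : ContDiff ℝ ∞ (lift Rsl) := hR
  set θ : ℝ := ‖transposeCL‖ with hθdef
  have hθ : 0 ≤ θ := norm_nonneg transposeCL
  set d2 : ℝ := ‖iteratedFDeriv ℝ 2 (lift Dsl) y‖ with hd2def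
  set d3 : ℝ := ‖iteratedFDeriv ℝ 3 (lift Dsl) y‖ with hd3def
  set μ1 : ℝ := |c| * ‖ofColsCL‖ * ‖iteratedFDeriv ℝ 1 (lift Rsl) y‖ with hμ1def
  set μ2 : ℝ := |c| * ‖ofColsCL‖ * ‖iteratedFDeriv ℝ 2 (lift Rsl) y‖ with hμ2def
  have hd2 : 0 ≤ d2 := norm_nonneg _
  have hd3 : 0 ≤ d3 := norm_nonneg _
  have hμ1 : 0 ≤ μ1 := by positivity
  have hμ2 : 0 ≤ μ2 := by positivity
  -- the three factors
  have hA := contDiff_gradPhiCL hD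
  have hM := contDiff_middleCL c hR
  set AT : ℝ³ → 𝕃 := fun z => transposeCL (gradPhiCL Dsl z) with hATdef
  have hAT : ContDiff ℝ ∞ AT := transposeCL.contDiff.comp hA
  have a0 : ‖gradPhiCL Dsl y‖ ≤ 2 := (norm_gradPhiCL_le Dsl y).trans (by linarith)
  have a1 : ‖iteratedFDeriv ℝ 1 (gradPhiCL Dsl) y‖ ≤ d2 := by rw [norm_iteratedFDeriv_gradPhiCL hD one_ne_zero]
  have a2 : ‖iteratedFDeriv ℝ 2 (gradPhiCL Dsl) y‖ ≤ d3 := by rw [norm_iteratedFDeriv_gradPhiCL hD two_ne_zero]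
  have m0 : ‖(1 : 𝕃) - c • ofColsCL (lift Rsl y)‖ ≤ 2 := by
    refine (norm_sub_le _ _).trans ?_
    have h1 : ‖(1 : 𝕃)‖ ≤ 1 := ContinuousLinearMap.norm_id_le
    have h2 : ‖c • ofColsCL (lift Rsl y)‖ ≤ 1 := by
      rw [norm_smul, Real.norm_eq_abs]
      exact (mul_le_mul_of_nonneg_left (ofColsCL.le_opNorm _) (abs_nonneg c)).trans (by rw [← mul_assoc]; exact hr0)
    linarith
  have m1 : ‖iteratedFDeriv ℝ 1 (fun z => (1 : 𝕃) - c • ofColsCL (lift Rsl z)) y‖ ≤ μ1 := by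
    rw [norm_iteratedFDeriv_const_sub_smul (f := fun z => ofColsCL (lift Rsl z)) (ofColsCL.contDiff.comp hR') _ c
      one_ne_zero, hμ1def, mul_assoc]
    exact mul_le_mul_of_nonneg_left (norm_iteratedFDeriv_clm_comp_le ofColsCL hR' 1 y) (abs_nonneg c)
  have m2 : ‖iteratedFDeriv ℝ 2 (fun z => (1 : 𝕃) - c • ofColsCL (lift Rsl z)) y‖ ≤ μ2 := by
    rw [norm_iteratedFDeriv_const_sub_smul (f := fun z => ofColsCL (lift Rsl z)) (ofColsCL.contDiff.comp hR') _ c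
      two_ne_zero, hμ2def, mul_assoc]
    exact mul_le_mul_of_nonneg_left (norm_iteratedFDeriv_clm_comp_le ofColsCL hR' 2 y) (abs_nonneg c)
  have t0 : ‖AT y‖ ≤ 2 * θ := by
    change ‖transposeCL (gradPhiCL Dsl y)‖ ≤ 2 * θ
    refine (transposeCL.le_opNorm _).trans ?_
    rw [← hθdef, mul_comm]
    exact mul_le_mul_of_nonneg_right a0 hθ
  have t1 : ‖iteratedFDeriv ℝ 1 AT y‖ ≤ θ * d2 :=
    (norm_iteratedFDeriv_clm_comp_le transposeCL hA 1 y).trans (mul_le_mul_of_nonneg_left a1 hθ)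
  have t2 : ‖iteratedFDeriv ℝ 2 AT y‖ ≤ θ * d3 :=
    (norm_iteratedFDeriv_clm_comp_le transposeCL hA 2 y).trans (mul_le_mul_of_nonneg_left a2 hθ)
  -- the product `P = ∇Φ (Id - cR)`
  set P : ℝ³ → 𝕃 := fun z => gradPhiCL Dsl z * ((1 : 𝕃) - c • ofColsCL (lift Rsl z)) with hPdef
  have hP : ContDiff ℝ ∞ P := hA.mul hM
  have p0 : ‖P y‖ ≤ 4 := by
    change ‖gradPhiCL Dsl y * ((1 : 𝕃) - c • ofColsCL (lift Rsl y))‖ ≤ 4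
    refine (norm_mul_le _ _).trans ?_
    nlinarith [norm_nonneg (gradPhiCL Dsl y), norm_nonneg ((1 : 𝕃) - c • ofColsCL (lift Rsl y))]
  have p1 : ‖iteratedFDeriv ℝ 1 P y‖ ≤ 2 * μ1 + 2 * d2 := by
    refine (norm_iteratedFDeriv_mul_one_le hA hM y).trans ?_
    exact add_le_add (mul_le_mul a0 m1 (norm_nonneg _) (by norm_num))
      (by rw [mul_comm]; exact mul_le_mul m0 a1 (norm_nonneg _) (by norm_num))
  have p2 : ‖iteratedFDeriv ℝ 2 P y‖ ≤ 2 * μ2 + 2 * d2 * μ1 + 2 * d3 := by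
    refine (norm_iteratedFDeriv_mul_two_le hA hM y).trans ?_
    refine add_le_add (add_le_add ?_ ?_) ?_
    · exact mul_le_mul a0 m2 (norm_nonneg _) (by norm_num)
    · rw [mul_assoc, mul_assoc]
      exact mul_le_mul_of_nonneg_left (mul_le_mul a1 m1 (norm_nonneg _) hd2) (by norm_num)
    · rw [mul_comm]; exact mul_le_mul m0 a2 (norm_nonneg _) (by norm_num)
  -- `R̃ = P ∇Φᵀ`
  have e : stressCL c Rsl Dsl = fun z => P z * AT z := rfl
  rw [e]
  refine ⟨?_, ?_⟩
  · refine (norm_iteratedFDeriv_mul_one_le hP hAT y).trans ?_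
    calc ‖P y‖ * ‖iteratedFDeriv ℝ 1 AT y‖ + ‖iteratedFDeriv ℝ 1 P y‖ * ‖AT y‖
        ≤ 4 * (θ * d2) + (2 * μ1 + 2 * d2) * (2 * θ) :=
          add_le_add (mul_le_mul p0 t1 (norm_nonneg _) (by norm_num))
            (mul_le_mul p1 t0 (norm_nonneg _) (by positivity))
      _ = θ * (8 * d2 + 4 * μ1) := by ring
  · refine (norm_iteratedFDeriv_mul_two_le hP hAT y).trans ?_
    calc ‖P y‖ * ‖iteratedFDeriv ℝ 2 AT y‖ +
          2 * ‖iteratedFDeriv ℝ 1 P y‖ * ‖iteratedFDeriv ℝ 1 AT y‖ + ‖iteratedFDeriv ℝ 2 P y‖ * ‖AT y‖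
        ≤ 4 * (θ * d3) + 2 * (2 * μ1 + 2 * d2) * (θ * d2) + (2 * μ2 + 2 * d2 * μ1 + 2 * d3) * (2 * θ) := by
          refine add_le_add (add_le_add ?_ ?_) ?_
          · exact mul_le_mul p0 t2 (norm_nonneg _) (by norm_num)
          · rw [mul_assoc, mul_assoc]
            exact mul_le_mul_of_nonneg_left (mul_le_mul p1 t1 (norm_nonneg _) (by positivity)) (by norm_num)
          · exact mul_le_mul p2 t0 (norm_nonneg _) (by positivity)
      _ = θ * (8 * d3 + 8 * μ1 * d2 + 4 * d2 ^ 2 + 4 * μ2) := by ring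

end Stress

/-! ## The curl through the lift -/

section Curl

/-- The curl as a linear function of the Jacobian: `curlCLM L = (L₁₂ - L₂₁, L₂₀ - L₀₂, L₀₁ - L₁₀)`
with `L_{ji} = (L e_j)_i`, so that `curl v (proj y) = curlCLM (D(lift v)(y))`. [folklore] -/
def curlCLM : 𝕃 →L[ℝ] ℝ³ :=
  LinearMap.toContinuousLinearMap
    { toFun := fun L => WithLp.toLp 2
        ![L (EuclideanSpace.single 1 1) 2 - L (EuclideanSpace.single 2 1) 1,
          L (EuclideanSpace.single 2 1) 0 - L (EuclideanSpace.single 0 1) 2,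
          L (EuclideanSpace.single 0 1) 1 - L (EuclideanSpace.single 1 1) 0]
      map_add' := fun L L' => by
        ext i; fin_cases i <;> simp <;> ring
      map_smul' := fun a L => by
        ext i; fin_cases i <;> simp <;> ring }

/-- `curl v (proj y) = curlCLM (D(lift v)(y))` for `C¹` fields. [folklore] -/
theorem curl_proj_eq {v : 𝕋³ → ℝ³} (hv : IsContDiff 1 v) (y : ℝ³) :
    curl v (proj y) = curlCLM (fderiv ℝ (lift v) y) := by
  simp only [curl, partialDeriv_eq_fderiv_apply hv, ← fderiv_lift]
  rfl

/-- `lift (curl v) = curlCLM ∘ D(lift v)` for `C¹` fields. [folklore] -/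
theorem lift_curl {v : 𝕋³ → ℝ³} (hv : IsContDiff 1 v) :
    lift (curl v) = fun y => curlCLM (fderiv ℝ (lift v) y) :=
  funext fun y => curl_proj_eq hv y

/-- `‖curl v‖ ≤ ‖curlCLM‖ ‖D(lift v)‖` pointwise. [folklore] -/
theorem norm_curl_proj_le {v : 𝕋³ → ℝ³} (hv : IsSmooth v) (y : ℝ³) :
    ‖curl v (proj y)‖ ≤ ‖curlCLM‖ * ‖iteratedFDeriv ℝ 1 (lift v) y‖ := by
  rw [curl_proj_eq (hv.isContDiff (by simp)), norm_iteratedFDeriv_one_eq_norm_fderiv]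
  exact curlCLM.le_opNorm _

/-- `‖∂ᵢ curl v‖ ≤ ‖curlCLM‖ ‖D²(lift v)‖` pointwise. [folklore] -/
theorem norm_partialDeriv_curl_proj_le {v : 𝕋³ → ℝ³} (hv : IsSmooth v) (i : Fin 3) (y : ℝ³) :
    ‖partialDeriv i (curl v) (proj y)‖ ≤ ‖curlCLM‖ * ‖iteratedFDeriv ℝ 2 (lift v) y‖ := by
  have hv' : ContDiff ℝ ∞ (lift v) := hv
  have hc : IsSmooth (curl v) := isSmooth_curl hv
  have hF : ContDiff ℝ ∞ (fderiv ℝ (lift v)) := hv'.fderiv_right le_rfl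
  rw [partialDeriv_eq_fderiv_apply (hc.isContDiff (by simp)), ← fderiv_lift,
    lift_curl (hv.isContDiff (by simp)), norm_iteratedFDeriv_two_eq_norm_fderiv_fderiv]
  have hd : HasFDerivAt (fun y => curlCLM (fderiv ℝ (lift v) y))
      (curlCLM.comp (fderiv ℝ (fderiv ℝ (lift v)) y)) y :=
    curlCLM.hasFDerivAt.comp y ((hF.differentiable (by simp)) y).hasFDerivAt
  rw [hd.fderiv, ContinuousLinearMap.comp_apply]
  refine (curlCLM.le_opNorm _).trans (mul_le_mul_of_nonneg_left ?_ (norm_nonneg _))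
  refine ((fderiv ℝ (fderiv ℝ (lift v)) y).le_opNorm _).trans ?_
  rw [PiLp.norm_single, norm_one, mul_one]

end Curl

end BDSV

end Literature.Analysis.FluidPDE
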